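import Summits.KontsevichZagierPeriods.KontsevichZagierPeriods.Theses.SymplecticScissors
import Literature.NumberTheory.Transcendental.AyoubPeriodSeries
import Literature.NumberTheory.Transcendental.AyoubPeriodSeriesKernel
import Literature.NumberTheory.Transcendental.AyoubPeriodSeriesPiAlgebraic
import Literature.NumberTheory.Transcendental.AyoubPeriodSeriesLocalizing
import Literature.NumberTheory.Transcendental.AyoubPeriodSeriesProofs
import Summits.KontsevichZagierPeriods.KontsevichZagierPeriods.Theorems.SymplecticScissorsTypeAGenerationStubExactDlogAux
import Summits.KontsevichZagierPeriods.KontsevichZagierPeriods.Theorems.SymplecticScissorsTypeAGenerationStubNormalForms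

/-!
# `TypeAGeneration` (stmt-KontsevichZagierPeriods-18392), line `Sketch`: one-variable polynomials
read in `ℂ[[z]]` (helper file of the change-of-variables engine (C3, n = 1), lead, cycle 2)

For a complex polynomial `p ∈ ℂ[t]` read in the variable `zᵢ` of Ayoub's algebra,
`Polynomial.aeval (X i : CSeries) p`, this file records the elementary calculus consumed by the
change-of-variables certificate (Ayoub 2015 Rem. 1.5): absolute summability (finite support),
variables (`zᵢ` only), the partial derivatives `∂ᵢ p(zᵢ) = p′(zᵢ)`, `∂ⱼ p(zᵢ) = 0` (`j ≠ i`), the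
faces `p(zᵢ)|_{zᵢ=1} = p(1)`, `p(zᵢ)|_{zᵢ=0} = p(0)`, membership in `𝒪_{ℚ-alg}(𝔻̄^∞)` when the
coefficients are algebraic, and `G|_{z_j=0} = G` for `G` free of `z_j`.

Elementary (folklore); no definition is introduced. Helper names carry the prefix `c3_`.
-/

noncomputable section

-- `Summit.KontsevichZagierPeriods.KontsevichZagierPeriods.…` is the tree's mandated layout (single-conjunct summit).
set_option linter.dupNamespace false

namespace Summit.KontsevichZagierPeriods.KontsevichZagierPeriods.TypeAGenerationLine

open Finsupp MvPowerSeries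
open Literature.NumberTheory.Transcendental
open Literature.NumberTheory.Transcendental.AyoubRel

/-! ## Monomials -/

/-- `aeval zᵢ (a tⁿ) = a zᵢⁿ`. [folklore] -/
theorem c3_aeval_monomial (i n : ℕ) (a : ℂ) :
    Polynomial.aeval (X i : CSeries) (Polynomial.monomial n a) = C a * X i ^ n := by
  rw [Polynomial.aeval_monomial]
  rfl

/-- `a zᵢⁿ` is the monomial `a z^{n eᵢ}`. [folklore] -/
theorem c3_C_mul_X_pow (i n : ℕ) (a : ℂ) : (C a * X i ^ n : CSeries) = monomial (single i n) a := by
  rw [X_pow_eq]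
  ext b
  rw [coeff_C_mul, coeff_monomial, coeff_monomial]
  split_ifs <;> simp

/-! ## Derivatives of `p(zᵢ)` -/

/-- **`∂ᵢ p(zᵢ) = p′(zᵢ)`**. [folklore] -/
theorem c3_pdz_aeval_self (i : ℕ) (p : Polynomial ℂ) :
    pdz i (Polynomial.aeval (X i : CSeries) p) =
      Polynomial.aeval (X i : CSeries) (Polynomial.derivative p) := by
  induction p using Polynomial.induction_on' with
  | add p q hp hq =>
    have e := w1_pdz_smul_add i (Polynomial.aeval (X i : CSeries) p) (Polynomial.aeval (X i : CSeries) q) 1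
    rw [one_smul, one_smul] at e
    rw [map_add, map_add, map_add, e, hp, hq]
  | monomial n a =>
    rw [Polynomial.derivative_monomial, c3_aeval_monomial, c3_aeval_monomial, w1_pdz_mul, w1_pdz_C,
      zero_mul, zero_add, w2_map_pow (w1_pdz_mul i) (n1_pdz_one i), w1_pdz_X, if_pos rfl, mul_one,
      map_mul, map_natCast]
    ring

/-- **`∂ⱼ p(zᵢ) = 0`** for `j ≠ i`. [folklore] -/
theorem c3_pdz_aeval_of_ne {i j : ℕ} (h : j ≠ i) (p : Polynomial ℂ) :
    pdz j (Polynomial.aeval (X i : CSeries) p) = 0 := by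
  induction p using Polynomial.induction_on' with
  | add p q hp hq =>
    have e := w1_pdz_smul_add j (Polynomial.aeval (X i : CSeries) p) (Polynomial.aeval (X i : CSeries) q) 1
    rw [one_smul, one_smul] at e
    rw [map_add, e, hp, hq, add_zero]
  | monomial n a =>
    rw [c3_aeval_monomial, w1_pdz_mul, w1_pdz_C, zero_mul, zero_add,
      w2_map_pow (w1_pdz_mul j) (n1_pdz_one j), w1_pdz_X, if_neg h.symm, mul_zero, mul_zero]

/-! ## Summability and variables -/

/-- `p(zᵢ)` has absolutely summable (finitely supported) coefficients. [folklore] -/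
theorem c3_summable_aeval (i : ℕ) (p : Polynomial ℂ) :
    Summable fun a : ℕ →₀ ℕ => ‖coeff a (Polynomial.aeval (X i : CSeries) p)‖ := by
  induction p using Polynomial.induction_on' with
  | add p q hp hq =>
    rw [map_add]
    exact s4_summable_norm_coeff_add hp hq
  | monomial n a =>
    rw [c3_aeval_monomial, c3_C_mul_X_pow]
    refine summable_of_ne_finset_zero (s := {single i n}) fun b hb => ?_
    rw [Finset.mem_singleton] at hb
    rw [coeff_monomial, if_neg hb, norm_zero]

/-- The constant `C c` has absolutely summable coefficients. [folklore] -/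
theorem c3_summable_C (c : ℂ) : Summable fun a : ℕ →₀ ℕ => ‖coeff a (C c : CSeries)‖ := by
  simpa only [MvPolynomial.coe_C] using s4_summable_norm_coeff_coe (MvPolynomial.C c)

/-- The variable `z_l` has absolutely summable coefficients. [folklore] -/
theorem c3_summable_X (l : ℕ) : Summable fun a : ℕ →₀ ℕ => ‖coeff a (X l : CSeries)‖ := by
  simpa only [MvPolynomial.coe_X] using s4_summable_norm_coeff_coe (MvPolynomial.X l)

/-- `p(zᵢ)` involves the variable `zᵢ` only. [folklore] -/
theorem c3_usesVar_aeval {i l : ℕ} {p : Polynomial ℂ}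
    (h : UsesVar (Polynomial.aeval (X i : CSeries) p) l) : l = i := by
  induction p using Polynomial.induction_on' with
  | add p q hp hq =>
    rw [map_add] at h
    rcases s6_usesVar_add h with h' | h'
    · exact hp h'
    · exact hq h'
  | monomial n a =>
    rw [c3_aeval_monomial, c3_C_mul_X_pow] at h
    obtain ⟨b, hb, hne⟩ := h
    rw [coeff_monomial] at hne
    split_ifs at hne with hbn
    · by_contra hli
      rw [hbn, single_apply, if_neg (Ne.symm hli)] at hb
      exact hb rfl
    · exact absurd rfl hne

/-! ## Faces of `p(zᵢ)` -/

/-- **`p(zᵢ)|_{zᵢ=1} = p(1)`**. [folklore] -/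
theorem c3_restrC_one_aeval_self (i : ℕ) (p : Polynomial ℂ) :
    restrC i 1 (Polynomial.aeval (X i : CSeries) p) = C (p.eval 1) := by
  induction p using Polynomial.induction_on' with
  | add p q hp hq =>
    rw [map_add, s4_restrC_add i (c3_summable_aeval i p) (c3_summable_aeval i q), hp, hq,
      Polynomial.eval_add, map_add]
  | monomial n a =>
    rw [c3_aeval_monomial, Polynomial.eval_monomial, one_pow, mul_one,
      s4_restrC_mul (c3_summable_C a) (s4_summable_norm_coeff_pow (c3_summable_X i) n), s4_restrC_C,
      s4_restrC_pow (c3_summable_X i), s4_restrC_X, if_pos rfl, one_pow, mul_one]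

/-- **`p(zᵢ)|_{zᵢ=0} = p(0)`**. [folklore] -/
theorem c3_restrC_zero_aeval_self (i : ℕ) (p : Polynomial ℂ) :
    restrC i 0 (Polynomial.aeval (X i : CSeries) p) = C (p.eval 0) := by
  induction p using Polynomial.induction_on' with
  | add p q hp hq =>
    rw [map_add, s8_restrC_zero_add, hp, hq, Polynomial.eval_add, map_add]
  | monomial n a =>
    rw [c3_aeval_monomial, Polynomial.eval_monomial, s8_restrC_zero_mul, s8_restrC_zero_C,
      n1_restrC_zero_pow, s8_restrC_zero_X_self, map_mul]
    rcases Nat.eq_zero_or_pos n with rfl | hn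
    · rw [pow_zero, pow_zero, map_one]
    · rw [zero_pow hn.ne', zero_pow hn.ne', map_zero]

/-- `G|_{z_j = 0} = G` for `G` free of `z_j`. [folklore] -/
theorem c3_restrC_zero_of_not_usesVar {G : CSeries} {j : ℕ} (h : ¬ UsesVar G j) :
    restrC j 0 G = G := by
  ext a
  rw [s8_coeff_restrC_zero]
  split_ifs with ha
  · rfl
  · symm
    by_contra hne
    exact h ⟨a, ha, hne⟩

/-! ## Membership -/

/-- Finite sums of elements of `𝒪_{k-alg}(𝔻̄^∞)` lie in it. [folklore] -/
theorem c3_sum_mem_Oan {k : Type} [Field k] (σ : k →+* ℂ) {ι : Type*} (s : Finset ι)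
    (g : ι → CSeries) (hg : ∀ l ∈ s, g l ∈ Oan σ) : ∑ l ∈ s, g l ∈ Oan σ := by
  classical
  induction s using Finset.induction_on with
  | empty => simpa using zero_mem_Oan σ
  | insert a s ha ih =>
    rw [Finset.sum_insert ha]
    exact add_mem_Oan σ (hg a (Finset.mem_insert_self a s))
      (ih fun l hl => hg l (Finset.mem_insert_of_mem hl))

/-- **`p(zᵢ) ∈ 𝒪_{ℚ-alg}(𝔻̄^∞)` for `p` with algebraic coefficients.** [folklore] -/
theorem c3_aeval_mem_Oan (i : ℕ) {p : Polynomial ℂ} (hp : ∀ n, IsAlgebraic ℚ (p.coeff n)) :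
    Polynomial.aeval (X i : CSeries) p ∈ Oan (algebraMap ℚ ℂ) := by
  rw [p.as_sum_support_C_mul_X_pow, map_sum]
  refine c3_sum_mem_Oan _ _ _ fun n _ => ?_
  rw [map_mul, map_pow, Polynomial.aeval_C, Polynomial.aeval_X]
  show (C (p.coeff n) : CSeries) * X i ^ n ∈ _
  rw [← smul_eq_C_mul]
  exact smul_mem_Oan _ (by obtain ⟨q, hq, h⟩ := hp n; exact ⟨q, hq, h⟩)
    (n1_pow_mem_Oan _ (s2_X_mem_Oan _ i) n)

/-- **Registered helper `stub_covPolyAux` (line `Sketch`, lead) — the polynomial package of the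
change-of-variables engine**: derivatives, faces, variables, summability and membership of `p(zᵢ)`.
[folklore] -/
theorem stub_covPolyAux :
    ∀ (i : ℕ) (p : Polynomial ℂ),
      pdz i (Polynomial.aeval (X i : CSeries) p) = Polynomial.aeval (X i : CSeries) (Polynomial.derivative p) ∧
      (∀ j : ℕ, j ≠ i → pdz j (Polynomial.aeval (X i : CSeries) p) = 0) ∧
      restrC i 1 (Polynomial.aeval (X i : CSeries) p) = C (p.eval 1) ∧
      restrC i 0 (Polynomial.aeval (X i : CSeries) p) = C (p.eval 0) ∧
      (∀ l : ℕ, UsesVar (Polynomial.aeval (X i : CSeries) p) l → l = i) ∧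
      (Summable fun a : ℕ →₀ ℕ => ‖MvPowerSeries.coeff a (Polynomial.aeval (X i : CSeries) p)‖) ∧
      ((∀ n, IsAlgebraic ℚ (p.coeff n)) → Polynomial.aeval (X i : CSeries) p ∈ Oan (algebraMap ℚ ℂ)) :=
  fun i p => ⟨c3_pdz_aeval_self i p, fun _ h => c3_pdz_aeval_of_ne h p, c3_restrC_one_aeval_self i p,
    c3_restrC_zero_aeval_self i p, fun _ h => c3_usesVar_aeval h, c3_summable_aeval i p,
    fun hp => c3_aeval_mem_Oan i hp⟩

end Summit.KontsevichZagierPeriods.KontsevichZagierPeriods.TypeAGenerationLine
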